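import Literature.AlgebraicGeometry.Resolution.HilbertSamuelSemicontinuitySharp
import Literature.AlgebraicGeometry.Resolution.HilbertSamuelGenericConstancyExcellent
import Literature.AlgebraicGeometry.Resolution.HilbertSamuelPermissible
import Literature.AlgebraicGeometry.Resolution.AlterationsBoundarySmoothLocus
import Literature.AlgebraicGeometry.Resolution.SNCStrataSmooth
import Literature.AlgebraicGeometry.Resolution.ComponentGluing
import Literature.Topology.NoetherianSpaces.UpperSemicontinuous
import HarnessLib

/-!
# [OURS · L1 W3.1] Upper semicontinuity of the Hilbert function `x ↦ H^{(0)}_{𝒪_{X,x}}` along the CLOSED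
# points of a scheme of finite type over a field (campaign helper for `CampaignW31EdgeHilbLsc`)

Cell `res-hironaka`, rung L, slot W3.1 (seat res-L1-s31-pv-2). The kernel input behind the lower
semicontinuity of the edge-algebra Hilbert function (`Theorems/MarkedTransferCampaignW31EdgeHilbertLsc.lean`,
`CampaignW31EdgeHilbLsc`): on a Noetherian scheme `X` locally of finite type over a field `K`, for every
closed point `x₀` there is an open `W ∋ x₀` such that `H^{(0)}_{𝒪_{X,x}} ≤ H^{(0)}_{𝒪_{X,x₀}}` (product order on
`ℕ^ℕ`) for every CLOSED point `x ∈ W` (`exists_isOpen_forall_hilbertFun_stalk_le`).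

This is the closed-point form of Bennett–Singh semicontinuity (Cossart–Jannsen–Saito, LNM 2270, Thm. 2.33),
assembled from the tree's kernel theorems: generic normal flatness along `cl{η}`
(`Scheme.exists_isOpen_isNormallyFlat_primeOfSpecializes`), generic regularity of `cl{η}` on the excellent
`X` (`Scheme.exists_isOpen_isRegularLocalRing_quotient_primeOfSpecializes`), the normal-flatness equality
`H^{(0)}_{𝒪_x} = H^{(c)}_{𝒪_η}` (`Scheme.hilbertFun_stalk_eq_of_isNormallyFlat`), Bennett's inequality in
Singh's sharp form `H^{(d)}_{𝒪_η} ≤ H^{(0)}_{𝒪_{x₀}}` in equal characteristic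
(`hilbertSamuelFun_add_le_of_ringKrullDim_quotient_eq_of_ringHom_field'`), and `c = d = dim cl{η}` at closed
points of the variety `cl{η}` (`ringKrullDim_stalk_eq_of_isClosed`). The CJS function `H_X = H^{(N-ψ_X)}`
is normalised by the local codimension `ψ_X`, which varies between closed points of a non-equidimensional
`X`; the statement needed by the campaign is the un-normalised `H^{(0)}` at closed points, proved here
directly by Noetherian induction over irreducible closed subsets (`exists_isOpen_forall_le_of_generic`, an
abstract closed-point variant of CJS Lemma 2.34 (a)).

HONEST FRAMING. Kernel theorems about Mathlib/tree objects; nothing here is a statement of H. Hironaka's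
manuscript [Hironaka2017] and nothing of it is asserted.

## References (context)
* V. Cossart, U. Jannsen, S. Saito, LNM 2270 (2020), Lemma 2.34, Thm. 2.33, Thm. 3.3. [CossartJannsenSaito2020]
* M. Herrmann, S. Ikeda, U. Orbanz, *Equimultiplicity and Blowing up* (1988), Thm. (29.1), (30.2).
  [HerrmannIkedaOrbanz1988]
-/

noncomputable section

set_option linter.dupNamespace false -- mandated namespace of this single-conjunct summit

open CategoryTheory TopologicalSpace IsLocalRing
open _root_.AlgebraicGeometry _root_.Topology
open Literature.RingTheory.HilbertSamuel Literature.AlgebraicGeometry.Resolution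
open Literature.Topology.NoetherianSpaces

namespace Summit.ResolutionOfSingularities.ResolutionOfSingularities.Theorems

namespace CampaignW31

universe u

/-! ## A closed-point semicontinuity criterion on Noetherian sober spaces -/

section Topology

variable {X : Type*} [TopologicalSpace X] {G : Type*} [Preorder G]

/-- **Closed-point variant of CJS Lemma 2.34 (a)** on a Noetherian quasi-sober space: let `H : X → G`,
`C ⊆ X` (the «closed points») and `x₀ : X`. If for every generization `η ⤳ x₀` there is an open `U ∋ η` with
`H x ≤ H x₀` for all `x ∈ U ∩ cl{η} ∩ C`, then there is an open `W ∋ x₀` with `H x ≤ H x₀` for all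
`x ∈ W ∩ C`. Proof by Noetherian induction over irreducible closed subsets: `x₀ ∉ cl(Z ∩ A)` for every
closed `Z`, where `A = {x ∈ C | ¬ H x ≤ H x₀}`. [cite: CossartJannsenSaito2020, Lemma 2.34 (a)] -/
theorem exists_isOpen_forall_le_of_generic [NoetherianSpace X] [QuasiSober X]
    (H : X → G) (C : Set X) (x₀ : X)
    (hgen : ∀ η : X, η ⤳ x₀ → ∃ U : Set X, IsOpen U ∧ η ∈ U ∧
      ∀ x ∈ U, x ∈ closure ({η} : Set X) → x ∈ C → H x ≤ H x₀) :
    ∃ W : Set X, IsOpen W ∧ x₀ ∈ W ∧ ∀ x ∈ W, x ∈ C → H x ≤ H x₀ := by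
  classical
  set A : Set X := {x | x ∈ C ∧ ¬ H x ≤ H x₀} with hA
  have key : x₀ ∉ closure (Set.univ ∩ A) := by
    refine NoetherianSpace.closeds_irreducible_induction (fun Z => x₀ ∉ closure (Z ∩ A)) ?_ ?_
      isClosed_univ
    · intro S hSf hSc hP
      rw [Set.sUnion_eq_biUnion, Set.iUnion₂_inter, hSf.closure_biUnion]
      simp only [Set.mem_iUnion, not_exists]
      exact fun t ht => hP t ht
    · intro Z hZ hZi ih
      by_cases hx₀ : x₀ ∈ Z
      · set η := hZi.genericPoint
        have hgp : IsGenericPoint η Z := hZi.isGenericPoint_genericPoint hZ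
        have hsp : η ⤳ x₀ := hgp.specializes hx₀
        obtain ⟨U, hU, hηU, hUle⟩ := hgen η hsp
        have hsub : Z ∩ A = (Z ∩ Uᶜ) ∩ A := by
          ext x
          simp only [Set.mem_inter_iff, Set.mem_compl_iff]
          constructor
          · rintro ⟨hxZ, hxA⟩
            refine ⟨⟨hxZ, fun hxU => hxA.2 ?_⟩, hxA⟩
            exact hUle x hxU (by rw [hgp.def]; exact hxZ) hxA.1
          · rintro ⟨⟨hxZ, -⟩, hxA⟩
            exact ⟨hxZ, hxA⟩
        rw [hsub]
        refine ih _ (hZ.inter hU.isClosed_compl) ?_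
        refine ssubset_iff_subset_ne.mpr ⟨Set.inter_subset_left, fun heq => ?_⟩
        have : η ∈ Z ∩ Uᶜ := heq.symm ▸ hgp.mem
        exact this.2 hηU
      · intro h
        exact hx₀ (closure_minimal Set.inter_subset_left hZ h)
  rw [Set.univ_inter] at key
  refine ⟨(closure A)ᶜ, isClosed_closure.isOpen_compl, key, fun x hx hxC => ?_⟩
  by_contra hle
  exact hx (subset_closure ⟨hxC, hle⟩)

end Topology

/-! ## Local dimension of `cl{η}` at closed points -/

section Scheme

variable {K : Type u} [Field K] {X : Scheme.{u}}

/-- For `η ⤳ x` with `x` a CLOSED point of a scheme locally of finite type over a field: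
`dim 𝒪_{X,x}/𝔭_η = dim cl{η}` (the local ring of the integral closed subscheme `cl{η}` at its closed point
`x` has the dimension of `cl{η}`). [cite: GortzWedhorn2020, Thm. 5.22] -/
theorem ringKrullDim_stalk_quotient_primeOfSpecializes_eq (f : X ⟶ Spec (.of K))
    [LocallyOfFiniteType f] {η x : X} (h : η ⤳ x) (hx : IsClosed ({x} : Set X)) :
    ringKrullDim (X.presheaf.stalk x ⧸ primeOfSpecializes h) =
      topologicalKrullDim
        (Scheme.IdealSheafData.vanishingIdeal ⟨closure ({η} : Set X), isClosed_closure⟩).subscheme := by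
  haveI : IsIntegral
      (Scheme.IdealSheafData.vanishingIdeal ⟨closure ({η} : Set X), isClosed_closure⟩).subscheme :=
    ComponentGluing.isIntegral_subscheme_vanishingIdeal _ isIrreducible_singleton.closure
  have hxV : x ∈ Set.range
      (Scheme.IdealSheafData.vanishingIdeal ⟨closure ({η} : Set X), isClosed_closure⟩).subschemeι := by
    rw [ComponentGluing.range_subschemeι_vanishingIdeal]
    exact specializes_iff_mem_closure.mp h
  obtain ⟨v, hv⟩ := hxV
  have hvcl : IsClosed ({v} : Set
      (Scheme.IdealSheafData.vanishingIdeal ⟨closure ({η} : Set X), isClosed_closure⟩).subscheme) := by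
    have : ({v} : Set _) =
        (Scheme.IdealSheafData.vanishingIdeal ⟨closure ({η} : Set X), isClosed_closure⟩).subschemeι ⁻¹'
          {x} := by
      ext w
      simp only [Set.mem_singleton_iff, Set.mem_preimage]
      constructor
      · rintro rfl; exact hv
      · intro hw
        exact (Scheme.Hom.isClosedEmbedding _).injective (hw.trans hv.symm)
    rw [this]
    exact hx.preimage (Scheme.Hom.continuous _)
  have h1 := ringKrullDim_stalk_eq_of_isClosed
    ((Scheme.IdealSheafData.vanishingIdeal ⟨closure ({η} : Set X), isClosed_closure⟩).subschemeι ≫ f) hvcl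
  rw [ringKrullDim_stalk_subscheme _ v] at h1
  subst hv
  rw [stalkIdeal_vanishingIdeal_closure h] at h1
  exact h1

/-! ## `H^{(0)}` is upper semicontinuous along the closed points -/

/-- **Upper semicontinuity of `x ↦ H^{(0)}_{𝒪_{X,x}}` along the closed points** of a Noetherian scheme locally
of finite type over a field `K`: for every closed point `x₀` there is an open `W ∋ x₀` with
`H^{(0)}_{𝒪_{X,x}} ≤ H^{(0)}_{𝒪_{X,x₀}}` (product order on `ℕ^ℕ`) for every closed point `x ∈ W`. Proof: the
closed-point criterion `exists_isOpen_forall_le_of_generic` with, along `cl{η}` for `η ⤳ x₀`, the generic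
normal-flatness equality `H^{(0)}_{𝒪_x} = H^{(c)}_{𝒪_η}` (CJS Thm. 3.3), Bennett–Singh `H^{(d)}_{𝒪_η} ≤ H^{(0)}_{𝒪_{x₀}}`
(sharp form, `𝒪_{X,x₀} ⊇ K`), and `c = d = dim cl{η}` at the closed points `x, x₀` of the variety `cl{η}`.
[cite: CossartJannsenSaito2020, Thm. 2.33] [cite: HerrmannIkedaOrbanz1988, Thm. (30.2)] -/
theorem exists_isOpen_forall_hilbertFun_stalk_le (f : X ⟶ Spec (.of K)) [LocallyOfFiniteType f]
    [IsNoetherian X] {x₀ : X} (hx₀ : IsClosed ({x₀} : Set X)) :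
    ∃ W : X.Opens, x₀ ∈ W ∧ ∀ x ∈ W, IsClosed ({x} : Set X) →
      hilbertFun (X.presheaf.stalk x) ≤ hilbertFun (X.presheaf.stalk x₀) := by
  have hexc : Scheme.IsExcellent X :=
    Scheme.isExcellent_of_locallyOfFiniteType Stacks07QW_field_holds f
  suffices hgen : ∀ η : X, η ⤳ x₀ → ∃ U : Set X, IsOpen U ∧ η ∈ U ∧
      ∀ x ∈ U, x ∈ closure ({η} : Set X) → x ∈ {x : X | IsClosed ({x} : Set X)} →
        hilbertFun (X.presheaf.stalk x) ≤ hilbertFun (X.presheaf.stalk x₀) by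
    obtain ⟨W, hW, hx₀W, hle⟩ := exists_isOpen_forall_le_of_generic
      (fun x : X => hilbertFun (X.presheaf.stalk x)) {x | IsClosed ({x} : Set X)} x₀ hgen
    exact ⟨⟨W, hW⟩, hx₀W, fun x hx hxc => hle x hx hxc⟩
  intro η hη
  obtain ⟨U₁, hηU₁, hU₁⟩ := Scheme.exists_isOpen_isNormallyFlat_primeOfSpecializes (X := X) η
  obtain ⟨U₂, hηU₂, hU₂⟩ :=
    Scheme.exists_isOpen_isRegularLocalRing_quotient_primeOfSpecializes hexc.isQuasiExcellent η
  refine ⟨(U₁ : Set X) ∩ U₂, U₁.isOpen.inter U₂.isOpen, ⟨hηU₁, hηU₂⟩, ?_⟩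
  rintro x ⟨hxU₁, hxU₂⟩ hxcl hxc
  have h : η ⤳ x := specializes_iff_mem_closure.mpr hxcl
  -- at `x`: `H^{(0)}[𝒪_x] = H^{(c)}[𝒪_η]` (generic normal flatness + regularity of `cl{η}`)
  haveI := hU₂ x hxU₂ h
  haveI : (primeOfSpecializes h).IsPrime := Ideal.IsPrime.comap _
  obtain ⟨c, hc⟩ := exists_nat_cast_eq_ringKrullDim (R := X.presheaf.stalk x ⧸ primeOfSpecializes h)
  have hx_eq := Scheme.hilbertFun_stalk_eq_of_isNormallyFlat h hc (hU₁ x hxU₁ h)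
  -- at `x₀`: Bennett–Singh `H^{(d)}[𝒪_η] ≤ H^{(0)}[𝒪_{x₀}]`
  haveI : (primeOfSpecializes hη).IsPrime := Ideal.IsPrime.comap _
  haveI : IsLocalRing (X.presheaf.stalk x₀ ⧸ primeOfSpecializes hη) :=
    IsLocalRing.of_surjective' (Ideal.Quotient.mk _) Ideal.Quotient.mk_surjective
  obtain ⟨d, hd⟩ :=
    exists_nat_cast_eq_ringKrullDim (R := X.presheaf.stalk x₀ ⧸ primeOfSpecializes hη)
  have hB : hilbertSamuelFun (X.presheaf.stalk η) d ≤ hilbertFun (X.presheaf.stalk x₀) := by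
    letI := (X.presheaf.stalkSpecializes hη).hom.toAlgebra
    haveI : IsLocalization.AtPrime (X.presheaf.stalk η) (primeOfSpecializes hη) :=
      isLocalizationAtPrime_stalkSpecializes hη
    have hG : IsGRing (X.presheaf.stalk x₀) :=
      Scheme.isGRing_stalk_of_isQuasiExcellent hexc.isQuasiExcellent x₀
    let κ₀ : K →+* X.presheaf.stalk x₀ :=
      (X.presheaf.germ ⊤ x₀ trivial).hom.comp (f.appTop.hom.comp (Scheme.ΓSpecIso (.of K)).inv.hom)
    have hB' := hilbertSamuelFun_add_le_of_ringKrullDim_quotient_eq_of_ringHom_field' κ₀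
      (fun q Q _ _ hqQ hadj _ =>
        module_finite_integralClosure_range_localization_quotient_of_isGRing hG Q _
          (ringKrullDim_localization_quotient_map_eq_one hqQ hadj))
      d (primeOfSpecializes hη) (X.presheaf.stalk η) hd 0
    rwa [zero_add, hilbertSamuelFun_zero] at hB'
  -- `c = d = dim cl{η}`
  have hcd : c = d := by
    have h1 := ringKrullDim_stalk_quotient_primeOfSpecializes_eq f h hxc
    have h2 := ringKrullDim_stalk_quotient_primeOfSpecializes_eq f hη hx₀
    rw [hc] at h1
    rw [hd] at h2
    have h12 : ((c : ℕ∞) : WithBot ℕ∞) = ((d : ℕ∞) : WithBot ℕ∞) := h1.trans h2.symm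
    exact_mod_cast h12
  calc hilbertFun (X.presheaf.stalk x) = hilbertSamuelFun (X.presheaf.stalk η) c := hx_eq
    _ = hilbertSamuelFun (X.presheaf.stalk η) d := by rw [hcd]
    _ ≤ hilbertFun (X.presheaf.stalk x₀) := hB

end Scheme

end CampaignW31

end Summit.ResolutionOfSingularities.ResolutionOfSingularities.Theorems

end
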